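import Mathlib
import HarnessLib
import Literature.Probability.LatticeModels.IsingThermodynamics
import Literature.Probability.LatticeModels.CriticalTwoPointLower
import Literature.Probability.LatticeModels.HighDimPointwiseTriviality
import Summits.CriticalPhenomena.Ising3DConformalLimit.Theorems.PrecisionLaplacianDirectCorrelationStableTailDcfStructureAux
import Summits.CriticalPhenomena.Ising3DConformalLimit.Theorems.PrecisionLaplacianDirectCorrelationStableTailDcfStructureAux2

/-!
# Stub `stub_dcfStructure` of line `self-energy-pick-inversion` for crux `PrecisionLaplacian.DirectCorrelationStableTail`
# (stmt-CriticalPhenomena-4799): the critical direct correlation function is summable and hyperoctahedrally invariant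

Statement (registered, expanded over tree declarations; package form
`IsSymmPotentialKernel (criticalTwoPoint 3) → Summable dcf ∧ IsHyperoctahedralInvariant dcf`).  Let
`G = criticalTwoPoint 3 = ⟨σ₀σ_x⟩⁺_{β_c}` on `ℤ³`, `G_A = (G(q - p))_{p,q ∈ A}` for finite `A ⊂ ℤ³`, and
`a(x) = inf_{A ∋ 0,x} -(G_A)⁻¹(0,x)` the direct correlation function.  HYPOTHESIS `H`: every `G_A` is a
symmetric potential (positive definite, `(G_A)⁻¹` a Z-matrix with nonnegative row sums).  CONCLUSION:
`a ∈ ℓ¹(ℤ³)`, and `a(x ∘ σ) = a(x)`, `a(x with x_j ↦ -x_j) = a(x)` for all coordinate permutations `σ` and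
coordinates `j`.

Proof.
* Invariance (`iInf_neg_inv_entry_map_equiv`): for a bijection `e` of `ℤ³` fixing `0` with
  `G(e q - e p) = G(q - p)` — the signed coordinate permutations, by the lattice symmetries of the plus state
  (Friedli–Velenik 2017, Exercise 3.14: `twoPointPlus_perm_invariant_holds`,
  `twoPointPlus_reflection_invariant_holds`) — `A ↦ e(A)` is a bijection of the index sets of the two infima
  and `G_{e(A)}` is `G_A` reindexed, so `(G_{e(A)})⁻¹(0, e x) = (G_A)⁻¹(0, x)` (`Matrix.inv_submatrix_equiv`).
* Summability.  Fix `i` and a finite `S ⊂ {x_i ≥ 2}`, `A = {0} ∪ S`.  Under `H`, `a(y) ≤ -(G_A)⁻¹(0,y)` for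
  `y ∈ S` (the infimum is over nonnegative terms by the Z-sign clause, `ciInf_le`) and the `0`-th row sum of
  `(G_A)⁻¹` is `≥ 0`, so `Σ_{y ∈ S} a(y) ≤ (G_A)⁻¹(0,0)` (`sum_halfspace_le`).  KEY BOUND
  `(G_A)⁻¹(0,0) ≤ 1/κ_i`, `κ_i = 1 - G(2e_i) > 0` (`inv_zero_zero_le`): by `inv_diag_le_of_coercive` it suffices
  that the quadratic form of `G_A` dominates `κ_i v_0²` (`coercive`); expanding
  (`quad_expand`, `G 0 = 1`), `Q(v) = v_0² + 2 v_0 C + B` with `C = Σ_s v_s G(s)`, `B = Σ v_s v_{s'} G(s' - s) ≥ 0`,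
  and the REFLECTION-POSITIVITY CROSS BOUND `C² ≤ G(2e_i) B` (registered helper
  `stub_dcfStructure_auxCrossBound`, aux file 1: nine-mirror RP of the critical correlators, item 1985
  `criticalCorrNineMirrorRP_proof`, and Cauchy–Schwarz twice, FILS 1978) gives
  `G(2e_i) v_0² + 2 v_0 C + B ≥ 0` (`quad_nonneg_of_sq_le`), i.e. `Q(v) ≥ κ_i v_0²`; `κ_i > 0` is `G(2e_i) < G 0`
  from positive definiteness of `G_{{0, 2e_i}}` (`apply_lt_apply_zero`).  The half-spaces `{x_i ≤ -2}` follow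
  by the reflection invariance (`sum_neg_halfspace_le`), `a ≥ 0` off `0` by the Z-sign clause, and the
  registered helper `stub_dcfStructure_auxSummable` (aux file 2) assembles summability from the six uniform
  half-space bounds and the finite cube `{‖x‖_∞ ≤ 1}`.
No open item is used (in particular not item 4803, and no finite-energy input).

Pure theorem file (no definitions).  References: C. Dellacherie, S. Martínez, J. San Martín, *Inverse
M-matrices and ultrametric matrices*, LNM 2118 (2014), ch. 2 [DellacherieMartinezSanmartin2014]; J. Fröhlich,
R. Israel, E. H. Lieb, B. Simon, Comm. Math. Phys. 62 (1978) 1–34, §3 [FrohlichIsraelLiebSimon1978];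
S. Friedli, Y. Velenik, *Statistical Mechanics of Lattice Systems* (CUP 2017), Exercise 3.14, Lemma 10.8.
-/

noncomputable section

namespace Summit.CriticalPhenomena.Ising3DConformalLimit.Cruxes.DirectCorrelationStableTail.SelfEnergyPickInversion

open MeasureTheory Filter Topology
open scoped BigOperators
open Literature.Probability.LatticeModels

/-! ### Part B: invariance of the direct correlation function under symmetries of the kernel -/

/-- Reindexing a kernel matrix along a symmetry `e` of the kernel (`G (e q - e p) = G (q - p)`, `e 0 = 0`)
does not change the `(0, x)` entry of its inverse: `(G_{e(A)})⁻¹(0, e x) = (G_A)⁻¹(0, x)`. -/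
theorem inv_entry_map_equiv (G : Site 3 → ℝ) (e : Site 3 ≃ Site 3) (he : e 0 = 0)
    (hG : ∀ p q : Site 3, G (e q - e p) = G (q - p)) (A : Finset (Site 3)) (x : Site 3)
    (h0 : (0 : Site 3) ∈ A) (hx : x ∈ A) (h0' : (0 : Site 3) ∈ A.map e.toEmbedding)
    (hx' : e x ∈ A.map e.toEmbedding) :
    (Matrix.of fun (p q : ↥(A.map e.toEmbedding)) => G (q.1 - p.1))⁻¹ ⟨0, h0'⟩ ⟨e x, hx'⟩ =
      (Matrix.of fun (p q : ↥A) => G (q.1 - p.1))⁻¹ ⟨0, h0⟩ ⟨x, hx⟩ := by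
  classical
  let φ : ↥A ≃ ↥(A.map e.toEmbedding) :=
    e.subtypeEquiv fun a => (Finset.mem_map' e.toEmbedding (s := A) (a := a)).symm
  have hM : (Matrix.of fun (p q : ↥(A.map e.toEmbedding)) => G (q.1 - p.1)) =
      (Matrix.of fun (p q : ↥A) => G (q.1 - p.1)).submatrix φ.symm φ.symm := by
    ext p q
    simp only [Matrix.submatrix_apply, Matrix.of_apply]
    have h : G ((φ.symm q : Site 3) - (φ.symm p : Site 3)) = G (q.1 - p.1) := by
      rw [← hG]
      simp [φ]
    exact h.symm
  have hφ0 : φ.symm ⟨0, h0'⟩ = ⟨0, h0⟩ := by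
    ext1
    simp [φ, Equiv.symm_apply_eq, he]
  have hφx : φ.symm ⟨e x, hx'⟩ = ⟨x, hx⟩ := by
    ext1
    simp [φ]
  rw [hM, Matrix.inv_submatrix_equiv, Matrix.submatrix_apply, hφ0, hφx]

/-- **Invariance of the direct correlation function under a symmetry of the kernel.**  If `e : ℤ³ ≃ ℤ³`
fixes `0` and `G (e q - e p) = G (q - p)`, then `inf_{B ∋ 0, e x} -(G_B)⁻¹(0, e x) = inf_{A ∋ 0, x} -(G_A)⁻¹(0, x)`:
`A ↦ e(A)` maps the second index set onto the first and preserves each term (`inv_entry_map_equiv`). -/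
theorem iInf_neg_inv_entry_map_equiv (G : Site 3 → ℝ) (e : Site 3 ≃ Site 3) (he : e 0 = 0)
    (hG : ∀ p q : Site 3, G (e q - e p) = G (q - p)) (x : Site 3) :
    (⨅ B : {B : Finset (Site 3) // (0 : Site 3) ∈ B ∧ e x ∈ B},
        -((Matrix.of fun (p q : ↥B.1) => G (q.1 - p.1))⁻¹ ⟨0, B.2.1⟩ ⟨e x, B.2.2⟩)) =
      ⨅ A : {A : Finset (Site 3) // (0 : Site 3) ∈ A ∧ x ∈ A},
        -((Matrix.of fun (p q : ↥A.1) => G (q.1 - p.1))⁻¹ ⟨0, A.2.1⟩ ⟨x, A.2.2⟩) := by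
  classical
  have hmem0 : ∀ A : Finset (Site 3), (0 : Site 3) ∈ A → (0 : Site 3) ∈ A.map e.toEmbedding := by
    intro A hA
    simpa [he] using Finset.mem_map_of_mem e.toEmbedding hA
  have hmemx : ∀ A : Finset (Site 3), x ∈ A → e x ∈ A.map e.toEmbedding := by
    intro A hA
    simpa using Finset.mem_map_of_mem e.toEmbedding hA
  let f : {A : Finset (Site 3) // (0 : Site 3) ∈ A ∧ x ∈ A} →
      {B : Finset (Site 3) // (0 : Site 3) ∈ B ∧ e x ∈ B} :=
    fun A => ⟨A.1.map e.toEmbedding, hmem0 A.1 A.2.1, hmemx A.1 A.2.2⟩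
  have hf : Function.Surjective f := by
    rintro ⟨B, hB0, hBx⟩
    refine ⟨⟨B.map e.symm.toEmbedding, ?_, ?_⟩, ?_⟩
    · simpa [Equiv.symm_apply_eq, he] using Finset.mem_map_of_mem e.symm.toEmbedding hB0
    · simpa using Finset.mem_map_of_mem e.symm.toEmbedding hBx
    · apply Subtype.ext
      simp only [f, Finset.map_map]
      convert Finset.map_refl (s := B) using 2
      ext y
      simp
  rw [← hf.iInf_comp]
  refine iInf_congr fun A => ?_
  simp only [f]
  rw [inv_entry_map_equiv G e he hG A.1 x A.2.1 A.2.2]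

/-- **Coordinate permutations.**  For the critical two-point function `G = ⟨σ₀σ_x⟩⁺_{β_c}` on `ℤ³` and a
permutation `σ` of the coordinates, `a_G (x ∘ σ) = a_G x` (lattice symmetry of the plus state,
Friedli–Velenik 2017, Exercise 3.14, through `iInf_neg_inv_entry_map_equiv`). -/
theorem iInf_neg_inv_entry_perm (σ : Equiv.Perm (Fin 3)) (x : Site 3) :
    (⨅ A : {A : Finset (Site 3) // (0 : Site 3) ∈ A ∧ (fun j => x (σ j)) ∈ A},
        -((Matrix.of fun (p q : ↥A.1) => criticalTwoPoint 3 (q.1 - p.1))⁻¹ ⟨0, A.2.1⟩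
          ⟨(fun j => x (σ j)), A.2.2⟩)) =
      ⨅ A : {A : Finset (Site 3) // (0 : Site 3) ∈ A ∧ x ∈ A},
        -((Matrix.of fun (p q : ↥A.1) => criticalTwoPoint 3 (q.1 - p.1))⁻¹ ⟨0, A.2.1⟩ ⟨x, A.2.2⟩) := by
  have hG : ∀ p q : Site 3, criticalTwoPoint 3 ((fun j => q (σ j)) - fun j => p (σ j)) =
      criticalTwoPoint 3 (q - p) := by
    intro p q
    have h : ((fun j => q (σ j)) - fun j => p (σ j)) = fun j => (q - p) (σ j) := by
      funext j
      simp
    rw [h]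
    exact twoPointPlus_perm_invariant_holds (criticalBeta_nonneg 3) σ (q - p)
  exact iInf_neg_inv_entry_map_equiv (criticalTwoPoint 3)
    ⟨fun y j => y (σ j), fun y j => y (σ.symm j), fun y => by funext j; simp, fun y => by funext j; simp⟩
    rfl hG x

/-- **Coordinate reflections.**  For the critical two-point function `G = ⟨σ₀σ_x⟩⁺_{β_c}` on `ℤ³` and a
coordinate `j`, `a_G (x with x_j ↦ -x_j) = a_G x` (lattice symmetry of the plus state, Friedli–Velenik 2017,
Exercise 3.14, through `iInf_neg_inv_entry_map_equiv`). -/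
theorem iInf_neg_inv_entry_reflect (j : Fin 3) (x : Site 3) :
    (⨅ A : {A : Finset (Site 3) // (0 : Site 3) ∈ A ∧ (Function.update x j (-x j)) ∈ A},
        -((Matrix.of fun (p q : ↥A.1) => criticalTwoPoint 3 (q.1 - p.1))⁻¹ ⟨0, A.2.1⟩
          ⟨(Function.update x j (-x j)), A.2.2⟩)) =
      ⨅ A : {A : Finset (Site 3) // (0 : Site 3) ∈ A ∧ x ∈ A},
        -((Matrix.of fun (p q : ↥A.1) => criticalTwoPoint 3 (q.1 - p.1))⁻¹ ⟨0, A.2.1⟩ ⟨x, A.2.2⟩) := by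
  have hinv : ∀ y : Site 3, Function.update (Function.update y j (-y j)) j
      (-(Function.update y j (-y j)) j) = y := by
    intro y
    funext k
    by_cases hk : k = j
    · subst hk; simp
    · simp [Function.update_of_ne hk]
  have hG : ∀ p q : Site 3, criticalTwoPoint 3 (Function.update q j (-q j) - Function.update p j (-p j)) =
      criticalTwoPoint 3 (q - p) := by
    intro p q
    have h : Function.update q j (-q j) - Function.update p j (-p j) =
        Function.update (q - p) j (-(q - p) j) := by
      funext k
      by_cases hk : k = j
      · subst hk; simp; ring
      · simp [Function.update_of_ne hk]
    rw [h]
    exact twoPointPlus_reflection_invariant_holds (criticalBeta_nonneg 3) j (q - p)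
  exact iInf_neg_inv_entry_map_equiv (criticalTwoPoint 3)
    ⟨fun y => Function.update y j (-y j), fun y => Function.update y j (-y j), hinv, hinv⟩
    (by funext k; by_cases hk : k = j <;> simp [hk]) hG x

/-! ### Part A: summability of the critical direct correlation function under `H` -/

/-- `G(2 e_i) < 1` for the critical two-point function under positive definiteness of its kernel matrices,
so `κ_i = 1 - G(2e_i) > 0`. -/
theorem one_sub_criticalTwoPoint_two_pos
    (hpd : ∀ A : Finset (Site 3), (Matrix.of fun (p q : ↥A) => criticalTwoPoint 3 (q.1 - p.1)).PosDef)
    (i : Fin 3) : 0 < 1 - criticalTwoPoint 3 (Pi.single i 2) := by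
  have hne : (Pi.single i (2 : ℤ) : Site 3) ≠ 0 := fun h => by simpa using congrFun h i
  have h := apply_lt_apply_zero (criticalTwoPoint 3) hpd criticalTwoPoint_neg hne
  rw [criticalTwoPoint_zero'] at h
  linarith

/-- **Coercivity of the critical kernel matrix on `{0} ∪ S`, `S ⊂ {x_i ≥ 2}`** (reflection positivity):
`(1 - G(2e_i)) v_0² ≤ Σ_{p,q} v_p v_q G(q - p)`. -/
theorem coercive
    (hpd : ∀ A : Finset (Site 3), (Matrix.of fun (p q : ↥A) => criticalTwoPoint 3 (q.1 - p.1)).PosDef)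
    (i : Fin 3) (S : Finset (Site 3)) (hS : ∀ s ∈ S, 2 ≤ s i) (h0 : (0 : Site 3) ∈ insert (0 : Site 3) S)
    (v : ↥(insert (0 : Site 3) S) → ℝ) :
    (1 - criticalTwoPoint 3 (Pi.single i 2)) * v ⟨0, h0⟩ ^ 2 ≤
      ∑ p, ∑ q, v p * v q * criticalTwoPoint 3 (q.1 - p.1) := by
  classical
  have hS0 : (0 : Site 3) ∉ S := fun h => by have := hS 0 h; simp at this
  let w : Site 3 → ℝ := fun s => if h : s ∈ insert (0 : Site 3) S then v ⟨s, h⟩ else 0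
  have hw : ∀ p : ↥(insert (0 : Site 3) S), v p = w p.1 := fun p => by simp only [w, dif_pos p.2]
  rw [quad_expand (criticalTwoPoint 3) criticalTwoPoint_neg S hS0 v w hw, hw ⟨0, h0⟩,
    criticalTwoPoint_zero']
  have hcross := stub_dcfStructure_auxCrossBound i S w hpd hS
  have hB : 0 ≤ ∑ s ∈ S, ∑ s' ∈ S, w s * w s' * criticalTwoPoint 3 (s' - s) := by
    have h := gram_nonneg (criticalTwoPoint 3) (fun A => (hpd A).posSemidef) (fun s : ↥S => s.1)
      (fun s => w s.1)
    rw [← Finset.sum_coe_sort S]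
    refine h.trans_eq (Finset.sum_congr rfl fun s _ => ?_)
    rw [← Finset.sum_coe_sort S]
  have hq := quad_nonneg_of_sq_le _ _ _ (w 0) (criticalTwoPoint_nonneg' _) hB hcross
  simp only at hq ⊢
  nlinarith [hq]

/-- **The key bound** `(G_{{0} ∪ S})⁻¹(0,0) ≤ 1/(1 - G(2e_i))` for `S ⊂ {x_i ≥ 2}` (coercivity tested on the
`0`-th column of the inverse). -/
theorem inv_zero_zero_le
    (hpd : ∀ A : Finset (Site 3), (Matrix.of fun (p q : ↥A) => criticalTwoPoint 3 (q.1 - p.1)).PosDef)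
    (i : Fin 3) (S : Finset (Site 3)) (hS : ∀ s ∈ S, 2 ≤ s i) (h0 : (0 : Site 3) ∈ insert (0 : Site 3) S) :
    (Matrix.of fun (p q : ↥(insert (0 : Site 3) S)) => criticalTwoPoint 3 (q.1 - p.1))⁻¹ ⟨0, h0⟩ ⟨0, h0⟩ ≤
      1 / (1 - criticalTwoPoint 3 (Pi.single i 2)) := by
  classical
  refine inv_diag_le_of_coercive _ ((Matrix.isUnit_iff_isUnit_det _).mp (hpd _).isUnit) ⟨0, h0⟩ _
    (one_sub_criticalTwoPoint_two_pos hpd i) fun v => ?_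
  simpa only [Matrix.of_apply] using coercive hpd i S hS h0 v

/-- **Half-space partial sums of the critical direct correlation function**: under `H`, for finite
`S ⊂ {x_i ≥ 2}`, `Σ_{y ∈ S} a(y) ≤ (G_{{0}∪S})⁻¹(0,0) ≤ 1/(1 - G(2e_i))` (`a(y) ≤ -(G_A)⁻¹(0,y)` for
`A = {0} ∪ S`, and the `0`-th row sum of `(G_A)⁻¹` is nonnegative). -/
theorem sum_halfspace_le
    (hH : ∀ A : Finset (Site 3), (Matrix.of fun (p q : ↥A) => criticalTwoPoint 3 (q.1 - p.1)).PosDef ∧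
      ∀ u v : ↥A, (u ≠ v → (Matrix.of fun (p q : ↥A) => criticalTwoPoint 3 (q.1 - p.1))⁻¹ u v ≤ 0) ∧
        0 ≤ ∑ w, (Matrix.of fun (p q : ↥A) => criticalTwoPoint 3 (q.1 - p.1))⁻¹ u w)
    (i : Fin 3) (S : Finset (Site 3)) (hS : ∀ s ∈ S, 2 ≤ s i) :
    ∑ y ∈ S, (⨅ A : {A : Finset (Site 3) // (0 : Site 3) ∈ A ∧ y ∈ A},
      -((Matrix.of fun (p q : ↥A.1) => criticalTwoPoint 3 (q.1 - p.1))⁻¹ ⟨0, A.2.1⟩ ⟨y, A.2.2⟩)) ≤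
      1 / (1 - criticalTwoPoint 3 (Pi.single i 2)) := by
  classical
  have hS0 : (0 : Site 3) ∉ S := fun h => by have := hS 0 h; simp at this
  have h0A : (0 : Site 3) ∈ insert (0 : Site 3) S := Finset.mem_insert_self _ _
  let r : Site 3 → ℝ := fun y => if h : y ∈ insert (0 : Site 3) S then
    (Matrix.of fun (p q : ↥(insert (0 : Site 3) S)) => criticalTwoPoint 3 (q.1 - p.1))⁻¹ ⟨0, h0A⟩ ⟨y, h⟩
    else 0
  have h1 : ∀ y ∈ S, (⨅ A : {A : Finset (Site 3) // (0 : Site 3) ∈ A ∧ y ∈ A},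
      -((Matrix.of fun (p q : ↥A.1) => criticalTwoPoint 3 (q.1 - p.1))⁻¹ ⟨0, A.2.1⟩ ⟨y, A.2.2⟩)) ≤ -r y := by
    intro y hy
    have hyA : y ∈ insert (0 : Site 3) S := Finset.mem_insert_of_mem hy
    have hy0 : y ≠ 0 := fun h => hS0 (h ▸ hy)
    have hr : r y = (Matrix.of fun (p q : ↥(insert (0 : Site 3) S)) =>
        criticalTwoPoint 3 (q.1 - p.1))⁻¹ ⟨0, h0A⟩ ⟨y, hyA⟩ := dif_pos hyA
    rw [hr]
    refine ciInf_le ⟨0, ?_⟩ (⟨insert (0 : Site 3) S, h0A, hyA⟩ :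
      {A : Finset (Site 3) // (0 : Site 3) ∈ A ∧ y ∈ A})
    rintro _ ⟨B, rfl⟩
    exact neg_nonneg.2 (((hH B.1).2 _ _).1 fun e => hy0 (Subtype.ext_iff.mp e).symm)
  have h2 : 0 ≤ ∑ q : ↥(insert (0 : Site 3) S), (Matrix.of fun (p q : ↥(insert (0 : Site 3) S)) =>
      criticalTwoPoint 3 (q.1 - p.1))⁻¹ ⟨0, h0A⟩ q := ((hH _).2 ⟨0, h0A⟩ ⟨0, h0A⟩).2
  have h3 : ∑ q : ↥(insert (0 : Site 3) S), (Matrix.of fun (p q : ↥(insert (0 : Site 3) S)) =>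
      criticalTwoPoint 3 (q.1 - p.1))⁻¹ ⟨0, h0A⟩ q = r 0 + ∑ y ∈ S, r y := by
    have h : ∑ q : ↥(insert (0 : Site 3) S), (Matrix.of fun (p q : ↥(insert (0 : Site 3) S)) =>
        criticalTwoPoint 3 (q.1 - p.1))⁻¹ ⟨0, h0A⟩ q = ∑ q : ↥(insert (0 : Site 3) S), r q.1 :=
      Finset.sum_congr rfl fun q _ => by simp only [r, dif_pos q.2]
    rw [h, Finset.sum_coe_sort (insert (0 : Site 3) S) r, Finset.sum_insert hS0]
  have h4 : r 0 = (Matrix.of fun (p q : ↥(insert (0 : Site 3) S)) =>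
      criticalTwoPoint 3 (q.1 - p.1))⁻¹ ⟨0, h0A⟩ ⟨0, h0A⟩ := dif_pos h0A
  have h5 := inv_zero_zero_le (fun A => (hH A).1) i S hS h0A
  calc _ ≤ ∑ y ∈ S, -r y := Finset.sum_le_sum h1
    _ = -∑ y ∈ S, r y := Finset.sum_neg_distrib _
    _ ≤ r 0 := by linarith
    _ ≤ _ := h4 ▸ h5

/-- **Registered stub `stub_dcfStructure`** (signature EXACTLY as registered on stmt-CriticalPhenomena-4799; package form:
`IsSymmPotentialKernel (criticalTwoPoint 3) → Summable dcf ∧ IsHyperoctahedralInvariant dcf`).  Under `H` (every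
finite kernel matrix of `G = criticalTwoPoint 3` is a symmetric potential) the critical direct correlation
function `a(x) = inf_{A ∋ 0,x} -(G_A)⁻¹(0,x)` is summable on `ℤ³` — half-space partial sums are bounded by
`(G_{{0}∪S})⁻¹(0,0) ≤ 1/(1 - G(2e_i))` through reflection positivity of the critical two-point function
(`sum_halfspace_le`, `stub_dcfStructure_auxCrossBound`) — and invariant under coordinate permutations and
reflections (`iInf_neg_inv_entry_perm`, `iInf_neg_inv_entry_reflect`, lattice symmetries of the plus state,
Friedli–Velenik 2017 Exercise 3.14).  Sources: DellacherieMartinezSanmartin2014 ch. 2;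
FrohlichIsraelLiebSimon1978 §3; FriedliVelenik2017. -/
theorem stub_dcfStructure :
    (∀ A : Finset (Site 3), (Matrix.of fun (p q : ↥A) => criticalTwoPoint 3 (q.1 - p.1)).PosDef ∧ ∀ u v :
      ↥A, (u ≠ v → (Matrix.of fun (p q : ↥A) => criticalTwoPoint 3 (q.1 - p.1))⁻¹ u v ≤ 0) ∧ 0 ≤ ∑ w,
      (Matrix.of fun (p q : ↥A) => criticalTwoPoint 3 (q.1 - p.1))⁻¹ u w) →
    Summable (fun x : Site 3 => (⨅ A : {A : Finset (Site 3) // (0 : Site 3) ∈ A ∧ x ∈ A}, -((Matrix.of fun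
      (p q : ↥A.1) => criticalTwoPoint 3 (q.1 - p.1))⁻¹ ⟨0, A.2.1⟩ ⟨x, A.2.2⟩))) ∧
    ((∀ (σ : Equiv.Perm (Fin 3)) (x : Site 3), (⨅ A : {A : Finset (Site 3) // (0 : Site 3) ∈ A ∧ (fun j =>
      x (σ j)) ∈ A}, -((Matrix.of fun (p q : ↥A.1) => criticalTwoPoint 3 (q.1 - p.1))⁻¹ ⟨0, A.2.1⟩ ⟨(fun j
      => x (σ j)), A.2.2⟩)) = (⨅ A : {A : Finset (Site 3) // (0 : Site 3) ∈ A ∧ x ∈ A}, -((Matrix.of fun (p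
      q : ↥A.1) => criticalTwoPoint 3 (q.1 - p.1))⁻¹ ⟨0, A.2.1⟩ ⟨x, A.2.2⟩))) ∧ ∀ (j : Fin 3) (x : Site 3),
      (⨅ A : {A : Finset (Site 3) // (0 : Site 3) ∈ A ∧ (Function.update x j (-x j)) ∈ A}, -((Matrix.of fun
      (p q : ↥A.1) => criticalTwoPoint 3 (q.1 - p.1))⁻¹ ⟨0, A.2.1⟩ ⟨(Function.update x j (-x j)), A.2.2⟩))
      = (⨅ A : {A : Finset (Site 3) // (0 : Site 3) ∈ A ∧ x ∈ A}, -((Matrix.of fun (p q : ↥A.1) =>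
      criticalTwoPoint 3 (q.1 - p.1))⁻¹ ⟨0, A.2.1⟩ ⟨x, A.2.2⟩))) := by
  intro hH
  refine ⟨?_, iInf_neg_inv_entry_perm, iInf_neg_inv_entry_reflect⟩
  have hnn : ∀ x : Site 3, x ≠ 0 → 0 ≤ (⨅ A : {A : Finset (Site 3) // (0 : Site 3) ∈ A ∧ x ∈ A},
      -((Matrix.of fun (p q : ↥A.1) => criticalTwoPoint 3 (q.1 - p.1))⁻¹ ⟨0, A.2.1⟩ ⟨x, A.2.2⟩)) := by
    intro x hx
    haveI : Nonempty {A : Finset (Site 3) // (0 : Site 3) ∈ A ∧ x ∈ A} := ⟨⟨{0, x}, by simp, by simp⟩⟩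
    refine le_ciInf fun A => ?_
    exact neg_nonneg.2 (((hH A.1).2 _ _).1 fun e => hx (Subtype.ext_iff.mp e).symm)
  -- a uniform constant for the six half-spaces
  let C : ℝ := ∑ i : Fin 3, 1 / (1 - criticalTwoPoint 3 (Pi.single i 2))
  have hCi : ∀ i : Fin 3, 1 / (1 - criticalTwoPoint 3 (Pi.single i 2)) ≤ C := fun i =>
    Finset.single_le_sum (fun j _ => (one_sub_criticalTwoPoint_two_pos (fun A => (hH A).1) j).le |>
      fun h => one_div_nonneg.mpr h) (Finset.mem_univ i)
  have hpos : ∀ (i : Fin 3) (S : Finset (Site 3)), (∀ s ∈ S, 2 ≤ s i) →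
      ∑ y ∈ S, (⨅ A : {A : Finset (Site 3) // (0 : Site 3) ∈ A ∧ y ∈ A},
        -((Matrix.of fun (p q : ↥A.1) => criticalTwoPoint 3 (q.1 - p.1))⁻¹ ⟨0, A.2.1⟩ ⟨y, A.2.2⟩)) ≤ C :=
    fun i S hS => (sum_halfspace_le hH i S hS).trans (hCi i)
  refine summable_of_halfspace_sum_le _ hnn C hpos fun i S hS => ?_
  exact sum_neg_halfspace_le _ i C (fun x => iInf_neg_inv_entry_reflect i x) (hpos i) S hS

end Summit.CriticalPhenomena.Ising3DConformalLimit.Cruxes.DirectCorrelationStableTail.SelfEnergyPickInversion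

end
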